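import Summits.CriticalPhenomena.PercolationContinuityZ3.Theorems.Transplant.FKDoubleFanNegCorrRim
import Summits.CriticalPhenomena.PercolationContinuityZ3.Theorems.Transplant.FKDoubleFanRimRim
import HarnessLib

/-!
# Double fans `K₂ ∨ P_{m+1}`: two consecutive rim edges are negatively correlated

Support file (`--supports stmt-CriticalPhenomena-4575`), FK sub-lane `prim-bschramm-fk-3` (gen 21); builds on p205010 (kernel theorem, internal
audit signed; external expert review pending).  No named facts, no sorries; standard axioms.  Memo `bschramm/prim-bschramm-fk-3/RIM-PAIRS.md` §3.
Layer 7 of the double-fan bridge: through the cut at block `j+1` (with the reversed suffix unfolded once, `restVec_succ`) the partition functions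
with the rim edges `c_j c_{j+1}` and `c_{j+1} c_{j+2}` pinned are the `rimRimZ` valuations of `…DoubleFanRimRim` with `u = Z_j`,
`s = restVec_{j+2} ∗ edgeAC ∗ edgeBC` (both in `InKE q`) and the spokes of `c_{j+1}` as the middle letters; the piecewise certificate of that
file gives **`negCorr_rim_rim`**: for `0 < q ≤ 1`, every weight vector on the double fan and every `j + 2 ≤ m`,
`φ(J_{c_j c_{j+1}} ∩ J_{c_{j+1} c_{j+2}}) ≤ φ(J_{c_j c_{j+1}}) φ(J_{c_{j+1} c_{j+2}})`.  With layers 3–6: EVERY PAIR OF ADJACENT EDGES of a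
weighted double fan other than two spokes of the same apex at non-adjacent rim vertices is negatively correlated in the kernel.
[cite: Grimmett2006, §3.9 eq. (3.94) (pp. 63–64); §1.4 eq. (1.20) (p. 15)] [folklore]
-/

noncomputable section

namespace Summit.CriticalPhenomena.PercolationContinuityZ3.Theorems

namespace FK

namespace ThreeApex

open MeasureTheory Literature.Probability.LatticeModels Literature.Probability.Percolation
open scoped Classical

variable {V : Type*} [Fintype V]

section Setting

variable {a b : V} {c : ℕ → V} {m : ℕ}
variable (hab : a ≠ b) (hinj : ∀ j k, j ≤ m → k ≤ m → c j = c k → j = k) (hca : ∀ j, j ≤ m → c j ≠ a) (hcb : ∀ j, j ≤ m → c j ≠ b)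
include hab hinj hca hcb

omit [Fintype V] hab in
/-- **The word with the consecutive rim edges `c_j c_{j+1}`, `c_{j+1} c_{j+2}` pinned**, through the cut at block `j+1`:
`rimRimZ q x_{j+1} y_{j+1} Z_j (restVec_{j+2} ∗ edgeAC(x_{j+2}) ∗ edgeBC(y_{j+2})) β₁ β₂`. [folklore] -/
theorem cut_pin_rim_rim (q : ℝ) (w : Sym2 V → unitInterval) {j : ℕ} (hj : j + 2 ≤ m) (β₁ β₂ : unitInterval) :
    transferDF q (Function.update (Function.update w s(c j, c (j + 1)) β₁) s(c (j + 1), c (j + 2)) β₂) a b c m =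
      rimRimZ q (wR w s(a, c (j + 1))) (wR w s(b, c (j + 1))) (zDF q w a b c j)
        (conv (restVec q w a b c (j + 2) (m - (j + 2))) (conv (edgeAC (wR w s(a, c (j + 2)))) (edgeBC (wR w s(b, c (j + 2))))))
        (β₁ : ℝ) (β₂ : ℝ) := by
  set w₁ := Function.update w s(c j, c (j + 1)) β₁ with hw₁
  set w₂ := Function.update w₁ s(c (j + 1), c (j + 2)) β₂ with hw₂
  have hj1 : j + 1 ≤ m := by omega
  have hlater1 : ∀ k, j + 2 < k → k ≤ m → ¬ ReadsAt a b c k s(c j, c (j + 1)) := fun k hk hkm hr =>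
    absurd ((readsAt_rim_iff hinj hca hcb hj1 hkm).1 hr) (by omega)
  have hlater2 : ∀ k, j + 2 < k → k ≤ m → ¬ ReadsAt a b c k s(c (j + 1), c (j + 2)) := fun k hk hkm hr =>
    absurd ((readsAt_rim_iff hinj hca hcb hj hkm).1 hr) (by omega)
  have hrest : restVec q w₂ a b c (j + 2) (m - (j + 2)) = restVec q w a b c (j + 2) (m - (j + 2)) := by
    rw [hw₂, restVec_update_eq q w₁ β₂ (m - (j + 2)) (j + 2) (by omega) hlater2, hw₁,
      restVec_update_eq q w β₁ (m - (j + 2)) (j + 2) (by omega) (fun k hk hkm => hlater1 k (by omega) hkm)]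
  have hbefore : zDF q w₂ a b c j = zDF q w a b c j := by
    rw [hw₂, zDF_update_eq_of_not_reads q w₁ β₂ j (fun k hk hr => absurd ((readsAt_rim_iff hinj hca hcb hj (by omega)).1 hr) (by omega)),
      hw₁, zDF_update_eq_of_not_reads q w β₁ j (fun k hk hr => absurd ((readsAt_rim_iff hinj hca hcb hj1 (by omega)).1 hr) (by omega))]
  have hβ1 : wR w₂ s(c j, c (j + 1)) = (β₁ : ℝ) := by
    rw [hw₂, wR_update_of_ne w₁ (rim_ne_rim hinj hj1 hj (by omega)), hw₁, wR_update_self]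
  have hβ2 : wR w₂ s(c (j + 1), c (j + 2)) = (β₂ : ℝ) := by rw [hw₂, wR_update_self]
  have hx1 : wR w₂ s(a, c (j + 1)) = wR w s(a, c (j + 1)) := by
    rw [hw₂, wR_update_of_ne w₁ (spokeA_ne_rim hca (j := j + 1) hj), hw₁, wR_update_of_ne w (spokeA_ne_rim hca (j := j + 1) hj1)]
  have hy1 : wR w₂ s(b, c (j + 1)) = wR w s(b, c (j + 1)) := by
    rw [hw₂, wR_update_of_ne w₁ (spokeB_ne_rim hcb (j := j + 1) hj), hw₁, wR_update_of_ne w (spokeB_ne_rim hcb (j := j + 1) hj1)]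
  have hx2 : wR w₂ s(a, c (j + 2)) = wR w s(a, c (j + 2)) := by
    rw [hw₂, wR_update_of_ne w₁ (spokeA_ne_rim hca (j := j + 2) hj), hw₁, wR_update_of_ne w (spokeA_ne_rim hca (j := j + 2) hj1)]
  have hy2 : wR w₂ s(b, c (j + 2)) = wR w s(b, c (j + 2)) := by
    rw [hw₂, wR_update_of_ne w₁ (spokeB_ne_rim hcb (j := j + 2) hj), hw₁, wR_update_of_ne w (spokeB_ne_rim hcb (j := j + 2) hj1)]
  have hd : m - (j + 1) = (m - (j + 2)) + 1 := by omega
  rw [transferDF_eq_cut q w₂ a b c hj1, hd, restVec_succ, hrest, zDF, hbefore, hβ1, hβ2, hx1, hy1, hx2, hy2]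
  rfl

/-- **TWO CONSECUTIVE RIM EDGES OF A DOUBLE FAN ARE NEGATIVELY CORRELATED** (`0 < q ≤ 1`, `card V = m + 3`, `w` supported on the double fan,
`j + 2 ≤ m`): `φ(J_{c_j c_{j+1}} ∩ J_{c_{j+1} c_{j+2}}) ≤ φ(J_{c_j c_{j+1}}) φ(J_{c_{j+1} c_{j+2}})`. [cite: Grimmett2006, §3.9 eq. (3.94) (pp. 63–64)] -/
theorem negCorr_rim_rim (hcard : Fintype.card V = m + 3) {q : ℝ} (hq0 : 0 < q) (hq1 : q ≤ 1) (w : Sym2 V → unitInterval)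
    (hsupp : ∀ e, e ∉ dfPairs a b c m → w e = 0) {j : ℕ} (hj : j + 2 ≤ m) :
    (rcMeasureW w q ∅).real ({ω : BondConfig V | s(c j, c (j + 1)) ∈ ω} ∩ {ω | s(c (j + 1), c (j + 2)) ∈ ω}) ≤
      (rcMeasureW w q ∅).real {ω : BondConfig V | s(c j, c (j + 1)) ∈ ω} *
        (rcMeasureW w q ∅).real {ω : BondConfig V | s(c (j + 1), c (j + 2)) ∈ ω} := by
  have hj1 : j + 1 ≤ m := by omega
  have he : s(c j, c (j + 1)) ∈ dfPairs a b c m := (mem_dfPairs_iff a b c m _).2 (Or.inr (Or.inr ⟨j, hj1, rfl⟩))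
  have hf : s(c (j + 1), c (j + 2)) ∈ dfPairs a b c m := (mem_dfPairs_iff a b c m _).2 (Or.inr (Or.inr ⟨j + 1, hj, rfl⟩))
  have hne : s(c (j + 1), c (j + 2)) ≠ s(c j, c (j + 1)) := (rim_ne_rim hinj hj1 hj (by omega)).symm
  set u := zDF q w a b c j with hu
  set s := conv (restVec q w a b c (j + 2) (m - (j + 2))) (conv (edgeAC (wR w s(a, c (j + 2)))) (edgeBC (wR w s(b, c (j + 2))))) with hs
  have hZ : ∀ β₁ β₂ : unitInterval, rcPartitionFunctionW (Function.update (Function.update w s(c j, c (j + 1)) β₁) s(c (j + 1), c (j + 2)) β₂) q ∅ =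
      rimRimZ q (wR w s(a, c (j + 1))) (wR w s(b, c (j + 1))) u s (β₁ : ℝ) (β₂ : ℝ) := by
    intro β₁ β₂
    rw [rcPartitionFunctionW_eq_transferDF hab hinj hca hcb hcard q _
      (supp_update_dfPair _ (supp_update_dfPair w hsupp he β₁) hf β₂),
      cut_pin_rim_rim hinj hca hcb q w hj β₁ β₂]
  have huK : InKE q u := inKE_zDF q w a b c j
  have hsK : InKE q s := InKE.mul (inKE_restVec q w a b c (m - (j + 2)) (j + 2))
    (InKE.step (IsLetter.ac (w _).2.1 (w _).2.2) (by
      rw [← mul_one (edgeBC (wR w s(b, c (j + 2)))), mul_def, one_def]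
      exact InKE.step (IsLetter.bc (w _).2.1 (w _).2.2) InKE.base))
  have key := InKE.rayleigh_rim_rim_nonneg (x := wR w s(a, c (j + 1))) (y := wR w s(b, c (j + 1))) hq0.le hq1
    (w s(a, c (j + 1))).2.1 (w s(a, c (j + 1))).2.2 (w s(b, c (j + 1))).2.1 (w s(b, c (j + 1))).2.2 huK hsK
  refine negCorr_of_pinned_rayleigh w hq0 hne ?_
  rw [hZ 1 1, hZ 0 0, hZ 1 0, hZ 0 1]
  simp only [Set.Icc.coe_one, Set.Icc.coe_zero]
  linarith [key]

end Setting

end ThreeApex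

end FK

end Summit.CriticalPhenomena.PercolationContinuityZ3.Theorems
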